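import Summits.ResolutionOfSingularities.ResolutionOfSingularities.Theorems.MarkedTransferCampaignW46ExitTreeBranching
import Summits.ResolutionOfSingularities.ResolutionOfSingularities.Theorems.ValuativeLuAlphaPTorsorCurveMonomializationDivisors
import HarnessLib

/-!
# Infinite branches of the marked quadratic tree, II: isolation propagates along a marked step

[OURS · L1 W4.6 rung (i-a)′, INVARIANT layer — cell res-hironaka, LADDER-RESOLUTION rung L, D-0089; campaign s46,
seat res-D-pv-044 AS res-L1-s46-pv-8; host route MarkedTransfer, `--supports stmt-ResolutionOfSingularities-16156
--as helper`.] HONEST FRAMING: nothing here is a statement of H. Hironaka's manuscript (2017-03-23, [Hironaka2017]);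
pure commutative algebra inside a field `K`, continuing `…ExitTreeBranching.lean`. AI-written; weaker than expert
review. No `sorry`; axioms standard. UNIVERSE: `K : Type` (the valuation-ring dictionary of the tree's
`PfaffLine.CurveMono` namespace, `ValuativeLuAlphaPTorsorCurveMonomializationDivisors.lean`, is stated in `Type`).

A marked node `⟨S, J⟩` is **isolated** (for the exponent `b`) if no prime element `q` of `S` has `J ⊆ (q^b)` — the
generic points of the curves through the closed point of `Spec S` are not in `Sing(J, b)` (hypothesis (h) of the
centre clause, supplied at stage `0` of a run by res-L1-s46-pv-9's dictionary from `Sing(E) ⊆ closed points`).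
PROVED: **isolation propagates along a marked step** (`isolated_of_markedStep`): if `⟨S, J⟩` is tame and isolated and
`S' ⊇ S[y/x]` is a two-dimensional regular first quadratic transform, then `(S', (J S' : (𝔪_S S')^b))` is isolated.
For the exceptional prime `x` of `S'` this is tameness (`J' = x^{r-b} · W S'` with `W` the weak transform, not
divisible by `x`, and `r - b < b`); for any other prime `q'` of `S'` the local ring `S'_{(q')}` is a valuation ring of
`K` not dominating `S`, hence (`CurveMono.exists_centre`) equal to `S_{(q)}` for a prime element `q` of `S` with
`q ∣ q'`, and `J S' = x^b J' ⊆ (q'^b)` would give `J ⊆ (q^b)`.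

## References

* O. Zariski, P. Samuel, *Commutative Algebra* II (1960), Appendix 5 and Ch. VI. [ZariskiSamuel1960]
-/

noncomputable section

open IsLocalRing

-- single-problem summit: the doubled namespace component `ResolutionOfSingularities` is forced
set_option linter.dupNamespace false

namespace Summit.ResolutionOfSingularities.ResolutionOfSingularities.Theorems.CampaignW46

open Literature.AlgebraicGeometry.Resolution
open Summit.ResolutionOfSingularities.ResolutionOfSingularities.Theorems.PfaffLine.CurveMono

variable {K : Type} [Field K] {b : ℕ}

/-! ## Generic lemmas -/

/-- In a domain: `(a^r · N : a^b) = a^{r-b} · N` for `b ≤ r`, `a ≠ 0`. [folklore] -/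
theorem colon_span_pow_mul_eq {D : Type*} [CommRing D] [IsDomain D] {a : D} (ha : a ≠ 0) (N : Ideal D)
    {r b : ℕ} (hbr : b ≤ r) :
    Submodule.colon (Ideal.span {a ^ r} * N) ((Ideal.span {a ^ b} : Ideal D) : Set D) =
      Ideal.span {a ^ (r - b)} * N := by
  obtain ⟨m, rfl⟩ : ∃ m, r = b + m := ⟨r - b, by omega⟩
  rw [show b + m - b = m by omega, Ideal.colon_span]
  ext z
  rw [Submodule.mem_colon_singleton, smul_eq_mul]
  constructor
  · intro hz
    -- `z a^b ∈ a^{b+m} N = a^b (a^m N)`: cancel `a^b`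
    rw [pow_add, ← Ideal.span_singleton_mul_span_singleton, mul_assoc, mul_comm z] at hz
    exact (Ideal.mem_span_singleton_mul.mp hz |> fun ⟨w, hw, he⟩ =>
      (mul_left_cancel₀ (pow_ne_zero b ha) he) ▸ hw)
  · intro hz
    rw [pow_add, ← Ideal.span_singleton_mul_span_singleton, mul_assoc, mul_comm z]
    exact Ideal.mul_mem_mul (Ideal.mem_span_singleton_self _) hz

/-- In a domain: `a · I ⊆ a · J ⇒ I ⊆ J` for `a ≠ 0`. [folklore] -/
theorem le_of_span_singleton_mul_le {D : Type*} [CommRing D] [IsDomain D] {a : D} (ha : a ≠ 0) {I J : Ideal D}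
    (h : Ideal.span {a} * I ≤ Ideal.span {a} * J) : I ≤ J := by
  intro z hz
  have := h (Ideal.mul_mem_mul (Ideal.mem_span_singleton_self a) hz)
  obtain ⟨w, hw, he⟩ := Ideal.mem_span_singleton_mul.mp this
  rwa [← mul_left_cancel₀ ha he]

/-! ## The controlled transform on the chart, continued -/

section Chart

variable {S : Subring K} [IsRegularLocalRing S] {x y : S}

/-- **The weak transform is not divisible by the exceptional parameter at `S'`** (`W ⊄ xA` on the chart lifts to the
localization `S' = A_Q`, `xA` being a prime below `Q`). [cite: HunekeSwanson2006, Lemma 14.3.4 (proof)] -/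
theorem map_weakTransform_not_le_span (hdim : ringKrullDim S = 2) (hm : maximalIdeal S = Ideal.span {x, y})
    (hx0 : x ≠ 0) (hpq : ∀ t, x ∣ y * t → x ∣ t) {J : Ideal S} {r : ℕ} (hJ : J ≤ maximalIdeal S ^ r)
    (hJr : ¬ J ≤ maximalIdeal S ^ (r + 1)) {S' : Subring K} [IsLocalRing S'] (h₁ : IsQuadraticTransform S S')
    (hle : chartAdjoin (K := K) x y ≤ S') :
    ¬ (weakTransformChart x y J r).map (Subring.inclusion hle) ≤
      Ideal.span {Subring.inclusion hle (chartIncl x y x)} := by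
  have hxm : x ∈ maximalIdeal S := hm ▸ Ideal.subset_span (by simp)
  have hym : y ∈ maximalIdeal S := hm ▸ Ideal.subset_span (by simp)
  have hx0K : ((x : S) : K) ≠ 0 := fun e => hx0 (Subtype.ext e)
  set A := chartAdjoin (K := K) x y with hAdef
  set Q : Ideal A := (maximalIdeal S').comap (Subring.inclusion hle) with hQdef
  haveI hQ : Q.IsPrime := Ideal.comap_isPrime _ _
  have hA : blowupRing S (x : K) = A := blowupRing_eq_adjoin hm
  have hR₁ : S' = (LocalSubring.ofPrime A Q).toSubring := h₁.eq_ofPrime_of_le hxm hx0 hA.le hle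
  haveI h𝔭 : (Ideal.span {chartIncl (K := K) x y x}).IsPrime := by
    rw [← map_maximalIdeal_chartIncl hm hx0]
    exact isPrime_map_incl (K := K) hx0 hpq hxm hym
  have h𝔭Q : Ideal.span {chartIncl (K := K) x y x} ≤ Q := by
    rw [Ideal.span_singleton_le_iff_mem, hQdef, Ideal.mem_comap]
    exact (incl_mem_maximalIdeal_iff h₁.dominates x).mpr hxm
  intro hle'
  apply weakTransform_not_le_span hdim hm hx0 hJ hJr
  intro w hw
  have hw' := hle' (Ideal.mem_map_of_mem (Subring.inclusion hle) hw)
  obtain ⟨s, hs⟩ := Ideal.mem_span_singleton'.mp hw'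
  -- `s = a / t`, so `w t = x a` in `A`
  have hsL : ((s : S') : K) ∈ (LocalSubring.ofPrime A Q).toSubring := hR₁ ▸ s.2
  obtain ⟨a, t, ht, hst⟩ := mem_ofPrime_iff.mp hsL
  have ht0 : ((t : A) : K) ≠ 0 := coe_ne_zero_of_not_mem ht
  have hwt : w * t = chartIncl x y x * a := by
    apply Subtype.ext
    have e : ((s : S') : K) * ((x : S) : K) = (w : K) := congrArg (fun z : S' => (z : K)) hs
    change (w : K) * (t : K) = ((x : S) : K) * (a : K)
    rw [← e, hst]
    field_simp
  have hmem : w * t ∈ Ideal.span {chartIncl (K := K) x y x} :=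
    hwt ▸ Ideal.mul_mem_right _ _ (Ideal.mem_span_singleton_self _)
  rcases h𝔭.mem_or_mem hmem with h | h
  · exact h
  · exact absurd (h𝔭Q h) ht

/-- `J S' = x^b · J'` on the chart of `x` (`J ⊆ 𝔪^b`). [folklore] -/
theorem extIdeal_eq_span_pow_mul_ctrlTransform (hm : maximalIdeal S = Ideal.span {x, y}) (hx0 : x ≠ 0)
    {J : Ideal S} (hJb : J ≤ maximalIdeal S ^ b) {S' : Subring K} (hle : chartAdjoin (K := K) x y ≤ S') :
    extIdeal J S' = Ideal.span {Subring.inclusion hle (chartIncl x y x) ^ b} * ctrlTransform b S J S' := by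
  have hSS' : S ≤ S' := (subring_le_adjoin S _).trans hle
  have hle' : extIdeal J S' ≤ Ideal.span {Subring.inclusion hle (chartIncl x y x) ^ b} := by
    rw [← Ideal.span_singleton_pow, ← extIdeal_maximalIdeal_eq_span hm hx0 hle, extIdeal_eq_map _ hSS',
      extIdeal_eq_map _ hSS', ← Ideal.map_pow]
    exact Ideal.map_mono hJb
  have h := eq_span_singleton_mul_colon hle'
  rw [ctrlTransform, extIdeal_maximalIdeal_eq_span hm hx0 hle, Ideal.span_singleton_pow, Ideal.colon_span]
  exact h

/-- `J' = x^{r-b} · W S'` on the chart of `x` (`J` of order `≥ r ≥ b`). [folklore] -/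
theorem ctrlTransform_eq_span_pow_mul_weakTransform (hm : maximalIdeal S = Ideal.span {x, y}) (hx0 : x ≠ 0)
    {J : Ideal S} {r : ℕ} (hJ : J ≤ maximalIdeal S ^ r) (hbr : b ≤ r) {S' : Subring K}
    (hle : chartAdjoin (K := K) x y ≤ S') :
    ctrlTransform b S J S' = Ideal.span {Subring.inclusion hle (chartIncl x y x) ^ (r - b)} *
      (weakTransformChart x y J r).map (Subring.inclusion hle) := by
  have hx0' : Subring.inclusion hle (chartIncl x y x) ≠ 0 := by
    intro e
    have := congrArg (fun z : S' => (z : K)) e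
    exact hx0 (Subtype.ext this)
  rw [ctrlTransform, extIdeal_eq_span_pow_mul_map_weakTransform hm hx0 hJ hle, extIdeal_maximalIdeal_eq_span hm hx0 hle,
    Ideal.span_singleton_pow]
  exact colon_span_pow_mul_eq hx0' _ hbr

/-- **Isolation propagates, chart form.** [cite: ZariskiSamuel1960, Appendix 5] -/
theorem not_le_span_prime_pow_of_chart (hdim : ringKrullDim S = 2) (hof : IsLocalRingOf S)
    (hm : maximalIdeal S = Ideal.span {x, y}) (hx0 : x ≠ 0) (hpq : ∀ t, x ∣ y * t → x ∣ t)
    {J : Ideal S} {r : ℕ} (hJ : J ≤ maximalIdeal S ^ r) (hJr : ¬ J ≤ maximalIdeal S ^ (r + 1))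
    (hbr : b ≤ r) (hr2 : r < 2 * b) (hiso : ∀ q : S, Prime q → ¬ J ≤ Ideal.span {q ^ b})
    {S' : Subring K} [IsRegularLocalRing S'] (h₁ : IsQuadraticTransform S S') (hd' : ringKrullDim S' = 2)
    (hle : chartAdjoin (K := K) x y ≤ S') (q' : S') (hq' : Prime q') :
    ¬ ctrlTransform b S J S' ≤ Ideal.span {q' ^ b} := by
  have hxm : x ∈ maximalIdeal S := hm ▸ Ideal.subset_span (by simp)
  have hx0K : ((x : S) : K) ≠ 0 := fun e => hx0 (Subtype.ext e)
  have hSS' : S ≤ S' := (subring_le_adjoin S _).trans hle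
  have hof' : IsLocalRingOf S' := h₁.isLocalRingOf hof
  set x' : S' := Subring.inclusion hle (chartIncl x y x) with hx'def
  have hx'K : (x' : K) = ((x : S) : K) := rfl
  have hx'0 : x' ≠ 0 := fun e => hx0K (by rw [← hx'K, e]; rfl)
  -- `x'` is a regular parameter of `S'`, hence prime
  obtain ⟨f, hm'⟩ := exists_maximalIdeal_eq_span_pair_of_isQuadraticTransform hm hx0 h₁ hle
  have hx'm : x' ∈ maximalIdeal S' := hm' ▸ Ideal.subset_span (Set.mem_insert _ _)
  have hx'prime : Prime x' := IsRegularLocalRing.prime_of_not_mem_sq hx'm (fst_not_mem_sq hd' hm')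
  set W := weakTransformChart (K := K) x y J r with hWdef
  have hWx : ¬ W.map (Subring.inclusion hle) ≤ Ideal.span {x'} :=
    map_weakTransform_not_le_span hdim hm hx0 hpq hJ hJr h₁ hle
  have hJ' : ctrlTransform b S J S' = Ideal.span {x' ^ (r - b)} * W.map (Subring.inclusion hle) :=
    ctrlTransform_eq_span_pow_mul_weakTransform hm hx0 hJ hbr hle
  intro hle'
  by_cases hdvd : q' ∣ x'
  · -- the exceptional prime: `J' = x^{r-b} W S' ⊆ (x^b)` forces `W S' ⊆ (x)`
    have hassoc : Associated q' x' := hq'.associated_of_dvd hx'prime hdvd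
    have hspan : Ideal.span {q' ^ b} = Ideal.span {x' ^ b} :=
      Ideal.span_singleton_eq_span_singleton.mpr (hassoc.pow_pow)
    rw [hspan, hJ'] at hle'
    apply hWx
    have e : Ideal.span {x' ^ b} = Ideal.span {x' ^ (r - b)} * Ideal.span {x' ^ (2 * b - r)} := by
      rw [Ideal.span_singleton_mul_span_singleton, ← pow_add, show r - b + (2 * b - r) = b by omega]
    rw [e] at hle'
    refine (le_of_span_singleton_mul_le (pow_ne_zero _ hx'0) hle').trans ?_
    rw [Ideal.span_singleton_le_iff_mem]
    exact Ideal.pow_mem_of_mem _ (Ideal.mem_span_singleton_self _) _ (by omega)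
  · -- a non-exceptional prime: compare with a prime of `S` through the valuation ring `S'_{(q')}`
    haveI hq'I : (Ideal.span {q'}).IsPrime := (Ideal.span_singleton_prime hq'.ne_zero).mpr hq'
    have hq'm : Ideal.span {q'} ≠ maximalIdeal S' := fun e => maximalIdeal_ne_span_singleton hd' q' e.symm
    obtain ⟨W', -, hS'W', hval', hnd', -⟩ := exists_valuationSubring_of_prime hd' hof' (Ideal.span {q'}) hq'm
    have hSW' : S ≤ W'.toSubring := hSS'.trans hS'W'
    -- `W'` does not dominate `S` (else `q' ∣ x`)
    have hndS : ¬ SubringDominates S W'.toSubring := by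
      intro hdom
      have hvx : W'.valuation ((x : S) : K) < 1 := valuation_lt_one_of_dominates hdom hxm
      rw [← hx'K, hval' x', Ideal.mem_span_singleton] at hvx
      exact hdvd hvx
    -- a non-zero element of `S` of positive value
    set A := chartAdjoin (K := K) x y with hAdef
    set Q : Ideal A := (maximalIdeal S').comap (Subring.inclusion hle) with hQdef
    haveI hQ : Q.IsPrime := Ideal.comap_isPrime _ _
    have hA : blowupRing S (x : K) = A := blowupRing_eq_adjoin hm
    have hR₁ : S' = (LocalSubring.ofPrime A Q).toSubring := h₁.eq_ofPrime_of_le hxm hx0 hA.le hle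
    have hq'L : ((q' : S') : K) ∈ (LocalSubring.ofPrime A Q).toSubring := hR₁ ▸ q'.2
    obtain ⟨a, t, ht, hqt⟩ := mem_ofPrime_iff.mp hq'L
    have ht0 : ((t : A) : K) ≠ 0 := coe_ne_zero_of_not_mem ht
    have hq'0K : ((q' : S') : K) ≠ 0 := fun e => hq'.ne_zero (Subtype.ext e)
    have ha0 : ((a : A) : K) ≠ 0 := by
      intro e; apply hq'0K; rw [hqt, e, zero_div]
    have hva : W'.valuation ((a : A) : K) < 1 := by
      have e : ((a : A) : K) = ((q' : S') : K) * ((t : A) : K) := by rw [hqt, div_mul_cancel₀ _ ht0]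
      have hvq' : W'.valuation ((q' : S') : K) < 1 := (hval' q').mpr (Ideal.mem_span_singleton_self _)
      have hvt : W'.valuation ((t : A) : K) ≤ 1 := (W'.valuation_le_one_iff _).mpr (hS'W' (hle t.2))
      rw [e, map_mul]
      calc W'.valuation ((q' : S') : K) * W'.valuation ((t : A) : K)
          ≤ W'.valuation ((q' : S') : K) * 1 := by gcongr
        _ < 1 := by rw [mul_one]; exact hvq'
    obtain ⟨n, β, -, hβ⟩ := exists_pow_mul_eq_chartIncl (K := K) hm hx0 a
    have hβK : ((β : S) : K) = ((x : S) : K) ^ n * ((a : A) : K) := by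
      have := congrArg (fun z : A => (z : K)) hβ
      simpa using this
    have hβ0 : ((β : S) : K) ≠ 0 := by rw [hβK]; exact mul_ne_zero (pow_ne_zero _ hx0K) ha0
    have hvβ : W'.valuation ((β : S) : K) < 1 := by
      have hvx : W'.valuation (((x : S) : K) ^ n) ≤ 1 :=
        (W'.valuation_le_one_iff _).mpr (pow_mem (hSW' x.2) n)
      rw [hβK, map_mul]
      calc W'.valuation (((x : S) : K) ^ n) * W'.valuation ((a : A) : K)
          ≤ 1 * W'.valuation ((a : A) : K) := by gcongr
        _ < 1 := by rw [one_mul]; exact hva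
    -- the centre of `W'` on `S` is a principal prime `(q)`, and `W' = S_{(q)}`
    obtain ⟨𝔮, h𝔮, hmem𝔮, h𝔮m, hβ𝔮, -, hW'eq, -⟩ := exists_centre hdim hof hSW' hndS (β : S).2 hβ0 hvβ
    obtain ⟨q, h𝔮q⟩ := exists_eq_span_singleton_of_ne_maximalIdeal hdim 𝔮 h𝔮m
    have hq0 : q ≠ 0 := by
      rintro rfl
      rw [Ideal.span_singleton_zero] at h𝔮q
      have : (⟨(β : K), (β : S).2⟩ : S) = 0 := by simpa [h𝔮q] using hβ𝔮
      exact hβ0 (congrArg (fun z : S => (z : K)) this)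
    have hq : Prime q := (Ideal.span_singleton_prime hq0).mp (h𝔮q ▸ h𝔮)
    have hq0K : ((q : S) : K) ≠ 0 := fun e => hq0 (Subtype.ext e)
    have hvq : W'.valuation ((q : S) : K) < 1 :=
      (hmem𝔮 q).mp (h𝔮q ▸ Ideal.mem_span_singleton_self q)
    -- `v(q') ≤ v(q)`: `q'` is a non-unit of `W' = S_{(q)}`, whose non-units are `q · S_{(q)}`
    have hvq'q : W'.valuation ((q' : S') : K) ≤ W'.valuation ((q : S) : K) := by
      have hq'W : ((q' : S') : K) ∈ (LocalSubring.ofPrime S 𝔮).toSubring := hW'eq ▸ hS'W' q'.2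
      obtain ⟨a₁, t₁, ht₁, hq't⟩ := mem_ofPrime_iff.mp hq'W
      have ht₁0 : ((t₁ : S) : K) ≠ 0 := coe_ne_zero_of_not_mem ht₁
      have ha₁ : a₁ ∈ 𝔮 := by
        by_contra ha₁
        -- then `t₁ / a₁ ∈ S_{(q)} = W'`, so `q'` is a unit of `W'`
        have hinv : (((q' : S') : K))⁻¹ ∈ W' := by
          have hmem : ((t₁ : S) : K) / ((a₁ : S) : K) ∈ (LocalSubring.ofPrime S 𝔮).toSubring :=
            div_mem_ofPrime t₁ ha₁
          rw [← hW'eq] at hmem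
          rw [hq't, inv_div]
          exact hmem
        have hvq' : W'.valuation ((q' : S') : K) < 1 := (hval' q').mpr (Ideal.mem_span_singleton_self _)
        rcases (valuation_lt_one_iff_or W' _).mp hvq' with h0 | hni
        · exact hq'0K h0
        · exact hni hinv
      rw [h𝔮q, Ideal.mem_span_singleton] at ha₁
      obtain ⟨a₂, rfl⟩ := ha₁
      have hfrac : ((a₂ : S) : K) / ((t₁ : S) : K) ∈ W' := by
        have := div_mem_ofPrime (A := S) (P := 𝔮) a₂ ht₁
        rw [← hW'eq] at this
        exact this
      have e : ((q' : S') : K) = ((q : S) : K) * (((a₂ : S) : K) / ((t₁ : S) : K)) := by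
        rw [hq't, Subring.coe_mul, mul_div_assoc]
      rw [e, map_mul]
      calc W'.valuation ((q : S) : K) * W'.valuation (((a₂ : S) : K) / ((t₁ : S) : K))
          ≤ W'.valuation ((q : S) : K) * 1 := by
            gcongr; exact (W'.valuation_le_one_iff _).mpr hfrac
        _ = W'.valuation ((q : S) : K) := mul_one _
    -- every `s ∈ J` is divisible by `q^b` in `S`
    apply hiso q hq
    intro s hs
    have hsS' : Subring.inclusion hSS' s ∈ extIdeal J S' := by
      rw [extIdeal_eq_map _ hSS']; exact Ideal.mem_map_of_mem _ hs
    rw [extIdeal_eq_span_pow_mul_ctrlTransform hm hx0 (hJ.trans (Ideal.pow_le_pow_right hbr)) hle] at hsS'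
    have hsq' : Subring.inclusion hSS' s ∈ Ideal.span {q' ^ b} :=
      (Ideal.mul_le_left.trans hle') hsS'
    obtain ⟨w, hw⟩ := Ideal.mem_span_singleton'.mp hsq'
    -- `v(s) ≤ v(q)^b`, so `s / q^b ∈ W' = S_{(q)}`
    have hvs : W'.valuation ((s : S) : K) ≤ W'.valuation ((q : S) : K) ^ b := by
      have e : ((s : S) : K) = ((w : S') : K) * ((q' : S') : K) ^ b := by
        have := congrArg (fun z : S' => (z : K)) hw
        simpa using this.symm
      rw [e, map_mul, map_pow]
      calc W'.valuation ((w : S') : K) * W'.valuation ((q' : S') : K) ^ b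
          ≤ 1 * W'.valuation ((q : S) : K) ^ b := by
            gcongr
            · exact (W'.valuation_le_one_iff _).mpr (hS'W' w.2)
        _ = _ := one_mul _
    have hmemW : ((s : S) : K) / ((q : S) : K) ^ b ∈ W' := by
      rw [← W'.valuation_le_one_iff, map_div₀, map_pow]
      have hvq0 : W'.valuation ((q : S) : K) ^ b ≠ 0 := pow_ne_zero _ ((map_ne_zero _).mpr hq0K)
      exact div_le_one_of_le₀ hvs zero_le
    have hmemL : ((s : S) : K) / ((q : S) : K) ^ b ∈ (LocalSubring.ofPrime S 𝔮).toSubring := by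
      rw [← hW'eq]; exact hmemW
    obtain ⟨a₃, t₃, ht₃, he⟩ := mem_ofPrime_iff.mp hmemL
    have ht₃0 : ((t₃ : S) : K) ≠ 0 := coe_ne_zero_of_not_mem ht₃
    have hst : s * t₃ = q ^ b * a₃ := by
      apply Subtype.ext
      simp only [Subring.coe_mul, Subring.coe_pow]
      have e := he
      field_simp at e
      linear_combination e
    have hqt₃ : ¬ q ∣ t₃ := by
      rw [h𝔮q, Ideal.mem_span_singleton] at ht₃; exact ht₃
    rw [Ideal.mem_span_singleton]
    exact hq.pow_dvd_of_dvd_mul_right b hqt₃ (Dvd.intro a₃ hst.symm)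

end Chart

/-! ## Isolation propagates along a marked step -/

/-- **Isolation propagates along a marked step**: if `⟨S, J⟩ → ⟨S', J'⟩` is a marked step out of an ISOLATED tame
node (no prime `q` of `S` with `J ⊆ (q^b)`) and `S'` is regular, then `⟨S', J'⟩` is isolated.
[cite: ZariskiSamuel1960, Appendix 5] -/
theorem isolated_of_markedStep {n n' : MarkedNode K} (h : MarkedStep b n n')
    (hiso : ∀ q : n.1, Prime q → ¬ n.2 ≤ Ideal.span {q ^ b}) (hreg' : IsRegularLocalRing n'.1) :
    ∀ q' : n'.1, Prime q' → ¬ n'.2 ≤ Ideal.span {q' ^ b} := by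
  classical
  obtain ⟨⟨hreg, hdim, hof, hJb, hJ2b⟩, _, h₁, hd', hJ'⟩ := h
  haveI := hreg
  haveI := hreg'
  obtain ⟨S, J⟩ := n
  obtain ⟨S', J'⟩ := n'
  dsimp only at hreg hdim hof hJb hJ2b h₁ hd' hJ' hiso hreg' ⊢
  subst hJ'
  -- the exact order `r` of `J`: `b ≤ r < 2b`
  have hb : 0 < b := by
    rcases Nat.eq_zero_or_pos b with h0 | h0
    · exfalso; apply hJ2b; rw [h0, mul_zero, pow_zero, Ideal.one_eq_top]; exact le_top
    · exact h0
  have hex : ∃ k, ¬ J ≤ maximalIdeal S ^ (k + 1) :=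
    ⟨2 * b - 1, by rwa [show 2 * b - 1 + 1 = 2 * b by omega]⟩
  set r := Nat.find hex with hrdef
  have hJr : ¬ J ≤ maximalIdeal S ^ (r + 1) := Nat.find_spec hex
  have hbr : b ≤ r := by
    by_contra hlt
    push Not at hlt
    exact hJr (hJb.trans (Ideal.pow_le_pow_right (show r + 1 ≤ b by omega)))
  have hr2 : r < 2 * b := by
    by_contra hge
    push Not at hge
    have := Nat.find_min hex (show 2 * b - 1 < r by omega)
    push Not at this
    apply hJ2b
    rwa [show 2 * b - 1 + 1 = 2 * b by omega] at this
  have hJ : J ≤ maximalIdeal S ^ r := by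
    rcases Nat.eq_zero_or_pos r with h0 | hpos
    · rw [h0, pow_zero, Ideal.one_eq_top]; exact le_top
    · have := Nat.find_min hex (show r - 1 < r by omega)
      push Not at this
      rwa [show r - 1 + 1 = r by omega] at this
  -- a good regular system of parameters, and the chart containing `S'`
  obtain ⟨u, v, huv, hup, hvp, huv', hvu'⟩ := exists_maximalIdeal_eq_span_pair hdim
  have hu0 : u ≠ 0 := hup.ne_zero
  have hv0 : v ≠ 0 := hvp.ne_zero
  have hpq : ∀ t, u ∣ v * t → u ∣ t := fun t ht => (hup.dvd_or_dvd ht).resolve_left huv'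
  have hqp : ∀ t, v ∣ u * t → v ∣ t := fun t ht => (hvp.dvd_or_dvd ht).resolve_left hvu'
  have hvu : maximalIdeal S = Ideal.span {v, u} := by rw [huv, Set.pair_comm]
  intro q' hq'
  rcases h₁.blowupRing_le_or huv with hX | hY
  · have hle : chartAdjoin (K := K) u v ≤ S' := (blowupRing_eq_adjoin (K := K) huv).symm.le.trans hX
    exact not_le_span_prime_pow_of_chart hdim hof huv hu0 hpq hJ hJr hbr hr2 hiso h₁ hd' hle q' hq'
  · have hle : chartAdjoin (K := K) v u ≤ S' := (blowupRing_eq_adjoin (K := K) hvu).symm.le.trans hY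
    exact not_le_span_prime_pow_of_chart hdim hof hvu hv0 hqp hJ hJr hbr hr2 hiso h₁ hd' hle q' hq'

/-- **Along a chain of marked steps out of an isolated node, every node is isolated.** [folklore] -/
theorem Chain.isolated {c : ℕ → MarkedNode K} (hc : ∀ i, MarkedStep b (c i) (c (i + 1)))
    (hiso : ∀ q : (c 0).1, Prime q → ¬ (c 0).2 ≤ Ideal.span {q ^ b}) (i : ℕ) :
    ∀ q : (c i).1, Prime q → ¬ (c i).2 ≤ Ideal.span {q ^ b} := by
  induction i with
  | zero => exact hiso
  | succ i ih =>
    have hreg' : IsRegularLocalRing (c (i + 1)).1 := by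
      obtain ⟨h, -⟩ := (hc (i + 1)).isTameNode; exact h
    exact isolated_of_markedStep (hc i) ih hreg'

end Summit.ResolutionOfSingularities.ResolutionOfSingularities.Theorems.CampaignW46

end
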